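import Literature.AnabelianGeometry.SemiGraphs.TemperedCurveGalois
import Literature.AnabelianGeometry.SemiGraphs.TemperedCurveBridge
import Literature.AnabelianGeometry.SemiGraphs.TemperedCompletionExistence
import Literature.AnabelianGeometry.SemiGraphs.TemperedCompletionExtension
import Literature.AnabelianGeometry.EtaleTheta.TemperedCoverings
import Literature.AnabelianGeometry.EtaleTheta.SettingCompletion
import Literature.AnabelianGeometry.AbsoluteAnabelian.AbsTopIThm26vHolds
import Literature.AnabelianGeometry.AbsoluteAnabelian.MLFGaloisElasticProofs
import Literature.AnabelianGeometry.AbsoluteAnabelian.AbsTopI.CharOpenBasis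
import HarnessLib

/-!
# [SemiAnbd] §6: «`Δ^temp_X ⊆ Π^temp_{X_K}` is characteristic» along the profinite completion,
# for the curve-level interface `TemperedCurve p`

S. Mochizuki, *Semi-graphs of anabelioids*, Publ. RIMS 42 (2006), §6 p. 69: "`1 → π₁^temp(X_K̄) →
π₁^temp(X_K) → G_K → 1` [...] we shall denote the profinite completion by means of a `∧`"; and
*Topics in absolute anabelian geometry I*, J. Math. Sci. Univ. Tokyo 19 (2012), Thm 2.6 (v) p. 22: for
the PROFINITE `Π_{X_K}` of a hyperbolic curve over an MLF "the kernel of the quotient `Π ↠ G` may be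
characterized group-theoretically".  In the abc-iut cell the TEMPERED form — every automorphism of the
topological group `Π^temp_{X_K}` carries `Δ^temp_X = Ker(Π^temp_{X_K} ↠ G_K)` onto itself,
`IsTopCharacteristic Π^temp_{X_K} Δ^temp_X` — is hypothesis (H1) of the bad-place consumers (e.g.
`Summit.ABC.IUTFork.TemperedCurveRef.bad_liftExists_of_char_of_cont`, LANA §5.3 (a)).  abc-iut-w5-d233's
`ThetaSettingDeltaCharacteristicCompletion/Genuine.lean` (p427416, p429527) reduce (H1) for [IUTchII] §1
SETTINGS `S : ThetaSetting` to one [AbsTopI] Thm 2.6 regime on a compatible completion package.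

THIS PROOF-ONLY FILE (no definitions, no named facts) gives the same reduction for the CURVE-LEVEL
interface `X : TemperedCurve p` of [SemiAnbd] §6 (`TemperedAnabelian.lean`, abc-iut-L3), where the base
field `K ⊆ ℚ̄_p` and the identification `G_K ⥲ Gal(K̄_K/K)` (`TemperedCurve.galoisIdentification`) are
part of the data, so that the completion package EXISTS UNCONDITIONALLY:

* `IsProfiniteCompletion.isTopCharacteristic_comap` — GENERAL: along a profinite completion
  `ι : F → F̂` ([SemiAnbd] §6), the inverse image of a subgroup of `F̂` carried onto itself by every
  automorphism of topological groups of `F̂` is carried onto itself by every automorphism of `F`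
  (universal property: automorphisms extend, `IsProfiniteCompletion.exists_continuousMulEquiv_extending`);
* `TemperedCurve.deltaTemp_eq_comap_ker_augHat` — `Δ^temp_X` is the inverse image of `Ker(Π_{X_K} → G_{ℚ_p})`
  under `Π^temp_{X_K} ↪ Π_{X_K}` (and of `Δ_X`, the closure of its image: abc-iut-L2's
  `SettingCompletion.comap_deltaHat`, reused);
* `TemperedCurve.isTopCharacteristic_deltaTemp_of_hat` / `_of_deltaHat` — (H1) for `X` from «`Δ_X ⊆ Π_{X_K}`
  characteristic» for the curve's OWN profinite completion (the interface fields `toHat`, `augHat`);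
* `TemperedCurve.deltaTemp_eq_comap_of_aug_compatible`, `isTopCharacteristic_deltaTemp_of_completion_compatible`
  (+ regimes `_coinvariantRankConstant` = [AbsTopI] Thm 2.6 (v) with FACT-LIST F-0001 BY NAME at the instance,
  `_starCondition` = [AbsAnab] Lemma 1.1.4 (ii) as printed with F-0011 + F-0012, `_proSigma` = Thm 2.6 (iv))
  — (H1) from a COMPATIBLE completion package `(E, ι, g)` into an extension `1 → Δ_E → Π_E → G_E → 1` with
  MLF base data;
* `TemperedCurve.exists_completion_package` — the compatible package EXISTS for EVERY `X : TemperedCurve p`,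
  hypothesis-free: `Π_E :=` the profinite completion of `Π^temp_{X_K}`, `G_E := Gal(K̄_K/K)`, `aug_E :=` the
  extension of `G_K ⥲ Gal(K̄_K/K) ∘ (Π^temp_{X_K} ↠ G_K)` along the completion, MLF base data `(p, K, id)`;
* `TemperedCurve.isTopCharacteristic_deltaTemp_of_regime` / `_of_exists_package` — the usable forms: (H1)
  for `X` modulo ONE Thm 2.6 (v) regime hypothesis (`Δ_E` topologically finitely generated +
  `CoinvariantRankConstant`) on compatible completion packages, resp. from ONE package in the regime.

HONEST SCOPE: the reduction is unconditional topological-group theory; what stays NAMED for a given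
curve is print's input at this point — the regime hypotheses of [AbsTopI] Thm 2.6 (v) ([AbsTopI] Prop 2.2:
`Δ` topologically finitely generated; the rank computation of [AbsAnab] Lemma 1.1.4 (ii)) for the profinite
`Π_{X_K}`, which print derives from the geometry of the curve and which the abstract interface
`TemperedCurve p` does not carry.  Nothing here bears on [IUTchIII] Cor. 3.12; no side is taken; typed ≠
proved elsewhere.
-/

noncomputable section

namespace Literature.AnabelianGeometry.SemiGraphs

open Literature.AnabelianGeometry.AbsoluteAnabelian
open Literature.AnabelianGeometry.EtaleTheta (IsTopCharacteristic)

universe u v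

/-! ### General: characteristic subgroups pulled back along a profinite completion -/

namespace IsProfiniteCompletion

variable {F : Type u} {Fhat : Type v} [Group F] [TopologicalSpace F]
  [Group Fhat] [TopologicalSpace Fhat] [IsTopologicalGroup Fhat] {ι : F →ₜ* Fhat}

/-- **Characteristic subgroups descend along the profinite completion.**  Let `ι : F → F̂` exhibit
`F̂` as the profinite completion of the topological group `F` ([SemiAnbd] §6 p. 69) and let `Δ̂ ≤ F̂` be
carried onto itself by EVERY automorphism of topological groups of `F̂`.  Then `ι⁻¹(Δ̂)` is carried onto
itself by every automorphism `α` of topological groups of `F`: `α` extends to `α̂ : F̂ ⥲ F̂` with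
`α̂ ∘ ι = ι ∘ α` (universal property), `α̂(Δ̂) = Δ̂`, and `ι⁻¹(Δ̂)` is read back — one inclusion for every
`α`, the other from the inclusion for `α⁻¹`. [cite: MochizukiSemiAnbd2006, §6 p.69] -/
theorem isTopCharacteristic_comap (hι : IsProfiniteCompletion ι) {Δh : Subgroup Fhat}
    (hchar : IsTopCharacteristic Fhat Δh) : IsTopCharacteristic F (Δh.comap ι.toMonoidHom) := by
  -- one inclusion for every automorphism `α` of `F`
  have key : ∀ α : F ≃ₜ* F,
      (Δh.comap ι.toMonoidHom).map α.toMulEquiv.toMonoidHom ≤ Δh.comap ι.toMonoidHom := by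
    intro α
    obtain ⟨Φ, hΦ⟩ := hι.exists_continuousMulEquiv_extending α
    rintro _ ⟨x, hx, rfl⟩
    rw [SetLike.mem_coe, Subgroup.mem_comap] at hx
    rw [Subgroup.mem_comap]
    -- `ι (α x) = Φ (ι x) ∈ Φ(Δ̂) = Δ̂`
    change ι (α x) ∈ Δh
    rw [← hΦ x, ← hchar Φ]
    exact ⟨ι x, hx, rfl⟩
  intro α
  refine le_antisymm (key α) ?_
  intro x hx
  exact ⟨α.symm x, key α.symm ⟨x, hx, rfl⟩, α.apply_symm_apply x⟩

end IsProfiniteCompletion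

/-! ### The curve-level interface: `Δ^temp_X` along `Π^temp_{X_K} ↪ Π_{X_K}` -/

namespace TemperedCurve

variable {p : ℕ} [Fact p.Prime] (X : TemperedCurve p)

/-- `x ∈ Δ^temp_X ↔ (Π^temp_{X_K} ↠ G_K)(x) = 1` (for the `G_K`-valued augmentation `augGK`).
[cite: MochizukiSemiAnbd2006, §6 p.69] -/
theorem mem_deltaTemp_iff_augGK (x : X.PiTemp) : x ∈ X.DeltaTemp ↔ X.augGK x = 1 := by
  rw [DeltaTemp, MonoidHom.mem_ker, Subtype.ext_iff, coe_augGK_apply]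
  rfl

/-- **`Δ^temp_X = (Π^temp_{X_K} ↪ Π_{X_K})⁻¹ Ker(Π_{X_K} → G_{ℚ_p})`**: the profinite augmentation
`augHat` of the interface extends `aug` (`augHat_comp`). [cite: MochizukiSemiAnbd2006, §6 p.69] -/
theorem deltaTemp_eq_comap_ker_augHat :
    X.DeltaTemp = X.augHat.toMonoidHom.ker.comap X.toHat.toMonoidHom := by
  ext x
  rw [Subgroup.mem_comap, MonoidHom.mem_ker, DeltaTemp, MonoidHom.mem_ker]
  change X.aug x = 1 ↔ X.augHat (X.toHat x) = 1
  rw [X.augHat_comp]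

/-- **(H1) for `X` from «`Ker(Π_{X_K} → G_{ℚ_p}) ⊆ Π_{X_K}` is characteristic»** for the curve's OWN
profinite completion `Π^temp_{X_K} ↪ Π_{X_K}` (interface fields `toHat`, `isProfiniteCompletion_toHat`,
`augHat`): every automorphism of topological groups of `Π^temp_{X_K}` carries `Δ^temp_X` onto itself.
[cite: MochizukiAbsTopI2012, Thm 2.6 (v) p.22] -/
theorem isTopCharacteristic_deltaTemp_of_hat
    (hchar : IsTopCharacteristic X.PiHat X.augHat.toMonoidHom.ker) :
    IsTopCharacteristic X.PiTemp X.DeltaTemp := by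
  rw [X.deltaTemp_eq_comap_ker_augHat]
  exact X.isProfiniteCompletion_toHat.isTopCharacteristic_comap hchar

/-- **(H1) for `X` from «`Δ_X ⊆ Π_{X_K}` is characteristic»** (`Δ_X` = the closure of the image of
`Δ^temp_X`, interface `DeltaHat`; `Δ^temp_X = (Π^temp_{X_K} ↪ Π_{X_K})⁻¹ Δ_X` is abc-iut-L2's
`SettingCompletion.comap_deltaHat`): the TEMPERED statement follows from the PROFINITE one of [AbsTopI]
Thm 2.6 (v). [cite: MochizukiAbsTopI2012, Thm 2.6 (v) p.22] -/
theorem isTopCharacteristic_deltaTemp_of_deltaHat (hchar : IsTopCharacteristic X.PiHat X.DeltaHat) :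
    IsTopCharacteristic X.PiTemp X.DeltaTemp := by
  rw [← Literature.AnabelianGeometry.EtaleTheta.SettingCompletion.comap_deltaHat X]
  exact X.isProfiniteCompletion_toHat.isTopCharacteristic_comap hchar

/-! ### (H1) from a compatible completion package into an extension `1 → Δ_E → Π_E → G_E → 1` -/

/-- **`Δ^temp_X = ι⁻¹(Δ_E)` from compatible augmentations.**  If `ι : Π^temp_{X_K} → Π_E` and an INJECTIVE
homomorphism `g : G_K → G_E` satisfy `aug_E ∘ ι = g ∘ (Π^temp_{X_K} ↠ G_K)`, then
`Δ^temp_X = ι⁻¹(Ker aug_E) = ι⁻¹(Δ_E)`. [cite: MochizukiSemiAnbd2006, §6 p.69] -/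
theorem deltaTemp_eq_comap_of_aug_compatible (E : FundamentalExtension.{0})
    (ι : X.PiTemp →ₜ* E.arith) (g : X.GK →* E.gal) (hg : Function.Injective g)
    (h : ∀ x, E.aug (ι x) = g (X.augGK x)) : X.DeltaTemp = E.geom.comap ι.toMonoidHom := by
  ext x
  rw [Subgroup.mem_comap, FundamentalExtension.mem_geom, mem_deltaTemp_iff_augGK]
  change X.augGK x = 1 ↔ E.aug (ι x) = 1
  rw [h]
  constructor
  · intro hx
    rw [hx, map_one]
  · intro hx
    exact hg (by rw [hx, map_one])

/-- **(H1) from a COMPATIBLE completion package, regime-free form**: `ι : Π^temp_{X_K} → Π_E` a profinite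
completion, `aug_E ∘ ι = g ∘ (Π^temp_{X_K} ↠ G_K)` with `g` injective, and every automorphism of
topological groups of `Π_E` carrying `Δ_E` onto itself (`PreservesGeom`) ⇒ every automorphism of
`Π^temp_{X_K}` carries `Δ^temp_X` onto itself. [cite: MochizukiAbsTopI2012, Thm 2.6 (v) p.22] -/
theorem isTopCharacteristic_deltaTemp_of_completion_compatible (E : FundamentalExtension.{0})
    (ι : X.PiTemp →ₜ* E.arith) (hι : IsProfiniteCompletion ι) (g : X.GK →* E.gal)
    (hg : Function.Injective g) (h : ∀ x, E.aug (ι x) = g (X.augGK x))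
    (hE : ∀ φ : E.arith ≃ₜ* E.arith, FundamentalExtension.PreservesGeom φ) :
    IsTopCharacteristic X.PiTemp X.DeltaTemp := by
  rw [X.deltaTemp_eq_comap_of_aug_compatible E ι g hg h]
  exact hι.isTopCharacteristic_comap fun φ => hE φ

/-- **(H1) from a compatible completion package, [AbsTopI] Thm 2.6 (v) regime** (`B : E.MLFBase`, `Δ_E`
topologically finitely generated, `CoinvariantRankConstant` = FACT-LIST F-0001 BY NAME at the instance `E`):
via `FundamentalExtension.preservesGeom_of_coinvariantRankConstant`. [cite: MochizukiAbsTopI2012, Thm 2.6 (v) p.22] -/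
theorem isTopCharacteristic_deltaTemp_of_completion_coinvariantRankConstant (E : FundamentalExtension.{0})
    (B : E.MLFBase) (hΔE : IsTopologicallyFinitelyGenerated E.geom) (hc : E.CoinvariantRankConstant)
    (ι : X.PiTemp →ₜ* E.arith) (hι : IsProfiniteCompletion ι) (g : X.GK →* E.gal)
    (hg : Function.Injective g) (h : ∀ x, E.aug (ι x) = g (X.augGK x)) :
    IsTopCharacteristic X.PiTemp X.DeltaTemp :=
  X.isTopCharacteristic_deltaTemp_of_completion_compatible E ι hι g hg h
    fun φ => FundamentalExtension.preservesGeom_of_coinvariantRankConstant B B hΔE hc hΔE hc φ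

/-- **(H1) from a compatible completion package, [AbsAnab] Lemma 1.1.4 (ii) regime as printed** (F-0011
`SplitsOverOpenSubgroup`, `Δ_E` topologically finitely generated, F-0012 `StarCondition`, BY NAME at `E`).
[cite: MochizukiAbsTopI2012, Thm 2.6 (v) p.22] -/
theorem isTopCharacteristic_deltaTemp_of_completion_starCondition (E : FundamentalExtension.{0})
    (B : E.MLFBase) (hs : E.SplitsOverOpenSubgroup) (hΔE : IsTopologicallyFinitelyGenerated E.geom)
    (hstar : E.StarCondition) (ι : X.PiTemp →ₜ* E.arith) (hι : IsProfiniteCompletion ι)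
    (g : X.GK →* E.gal) (hg : Function.Injective g) (h : ∀ x, E.aug (ι x) = g (X.augGK x)) :
    IsTopCharacteristic X.PiTemp X.DeltaTemp :=
  X.isTopCharacteristic_deltaTemp_of_completion_compatible E ι hι g hg h
    fun φ => FundamentalExtension.preservesGeom_of_starCondition B B hs hΔE hstar hs hΔE hstar φ

/-- **(H1) from a compatible completion package, [AbsTopI] Thm 2.6 (iv) regime** (`Δ_E` topologically
finitely generated and pro-`Σ` for a proper subset `Σ ⊊ Primes`; the elasticity of `G_E ≅ G_K` is
abc-iut-w5-d206's theorem inside `MLFBase.preservesGeom`). [cite: MochizukiAbsTopI2012, Thm 2.6 (iv) p.22] -/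
theorem isTopCharacteristic_deltaTemp_of_completion_proSigma (E : FundamentalExtension.{0})
    (B : E.MLFBase) (hΔE : E.GeomTFG) {Sigma : Set ℕ} (hSigsub : Sigma ⊆ {q | q.Prime})
    (hSigne : Sigma ≠ {q | q.Prime}) (hpro : IsProSet E.geom Sigma) (ι : X.PiTemp →ₜ* E.arith)
    (hι : IsProfiniteCompletion ι) (g : X.GK →* E.gal) (hg : Function.Injective g)
    (h : ∀ x, E.aug (ι x) = g (X.augGK x)) : IsTopCharacteristic X.PiTemp X.DeltaTemp :=
  X.isTopCharacteristic_deltaTemp_of_completion_compatible E ι hι g hg h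
    fun φ => FundamentalExtension.MLFBase.preservesGeom B B hΔE hΔE hSigsub hSigne hpro hSigsub
      hSigne hpro φ

/-! ### Non-vacuity: the compatible completion package exists for every curve-level datum -/

/-- **The compatible completion package EXISTS for every `X : TemperedCurve p`**, hypothesis-free: take
`Π_E :=` the profinite completion of `Π^temp_{X_K}` ([SemiAnbd] §6 p. 69, abc-iut
`IsProfiniteCompletion.exists_isProfiniteCompletion`), `G_E := Gal(K̄_K/K)` for the base field `K ⊆ ℚ̄_p`
of `X` (finite over `ℚ_p` by the interface), `aug_E :=` the continuous extension of
`G_K ⥲ Gal(K̄_K/K) ∘ (Π^temp_{X_K} ↠ G_K)` along the completion (universal property,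
`IsProfiniteCompletion.exists_extension`; surjective because `Π^temp_{X_K} ↠ G_K` is), the identification
`G_K ⥲ Gal(K̄_K/K)` being abc-iut-L3's `TemperedCurve.galoisIdentification`, with MLF base data `(p, K, id)`.
[cite: MochizukiSemiAnbd2006, §6 p.69] -/
theorem exists_completion_package :
    ∃ (E : FundamentalExtension.{0}) (_ : E.MLFBase) (ι : X.PiTemp →ₜ* E.arith) (g : X.GK →* E.gal),
      IsProfiniteCompletion ι ∧ Function.Injective g ∧ ∀ x, E.aug (ι x) = g (X.augGK x) := by
  haveI : FiniteDimensional ℚ_[p] X.K := X.finiteDimensional_K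
  haveI : CharZero X.K := charZero_of_injective_algebraMap (algebraMap ℚ_[p] X.K).injective
  obtain ⟨P, ι, hι⟩ := IsProfiniteCompletion.exists_isProfiniteCompletion X.PiTemp
  -- the continuous homomorphism `Π^temp_{X_K} ↠ G_K ⥲ Gal(K̄_K/K)`
  let eK := X.galoisIdentification
  obtain ⟨Φ, hΦ⟩ := IsProfiniteCompletion.exists_extension hι (X.augK eK)
  have hψ : ∀ x, X.augK eK x = eK (X.augGK x) := fun _ => rfl
  have hsurj : Function.Surjective Φ := by
    intro y
    obtain ⟨x, hx⟩ := X.augK_surjective eK y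
    exact ⟨ι x, by rw [hΦ, hx]⟩
  let E : FundamentalExtension.{0} :=
    { arith := P
      gal := absoluteGaloisGrp X.K
      aug := Φ
      aug_surjective := hsurj }
  refine ⟨E, { p := p, K := X.K, galIso := ContinuousMulEquiv.refl _ }, ι,
    eK.toMulEquiv.toMonoidHom, hι, eK.injective, fun x => ?_⟩
  change Φ (ι x) = eK (X.augGK x)
  rw [hΦ, hψ]

/-- **(H1) for `X` modulo ONE [AbsTopI] Thm 2.6 (v) regime hypothesis** quantified over compatible
completion packages with MLF base data — the only named input left (`Δ_E` topologically finitely generated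
+ `CoinvariantRankConstant`, FACT-LIST F-0001 at the instance; print: [AbsTopI] Prop 2.2 and the rank
computation of [AbsAnab] Lemma 1.1.4 (ii) for the profinite `Π_{X_K}`); the package itself is supplied by
`exists_completion_package`. [cite: MochizukiAbsTopI2012, Thm 2.6 (v) p.22] -/
theorem isTopCharacteristic_deltaTemp_of_regime
    (hreg : ∀ (E : FundamentalExtension.{0}) (_ : E.MLFBase) (ι : X.PiTemp →ₜ* E.arith)
      (g : X.GK →* E.gal), IsProfiniteCompletion ι → Function.Injective g →
        (∀ x, E.aug (ι x) = g (X.augGK x)) →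
        IsTopologicallyFinitelyGenerated E.geom ∧ E.CoinvariantRankConstant) :
    IsTopCharacteristic X.PiTemp X.DeltaTemp := by
  obtain ⟨E, B, ι, g, hι, hg, h⟩ := X.exists_completion_package
  obtain ⟨hΔE, hc⟩ := hreg E B ι g hι hg h
  exact X.isTopCharacteristic_deltaTemp_of_completion_coinvariantRankConstant E B hΔE hc ι hι g hg h

/-- **(H1) for `X` from the EXISTENCE of one compatible completion package in the [AbsTopI] Thm 2.6 (v)
regime** (the usable form: a consumer supplies ONE package — e.g. the one of `exists_completion_package` —
with `Δ_E` topologically finitely generated and `CoinvariantRankConstant`, FACT-LIST F-0001 BY NAME at the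
instance). [cite: MochizukiAbsTopI2012, Thm 2.6 (v) p.22] -/
theorem isTopCharacteristic_deltaTemp_of_exists_package
    (h : ∃ (E : FundamentalExtension.{0}) (_ : E.MLFBase) (ι : X.PiTemp →ₜ* E.arith)
      (g : X.GK →* E.gal), IsProfiniteCompletion ι ∧ Function.Injective g ∧
        (∀ x, E.aug (ι x) = g (X.augGK x)) ∧
        IsTopologicallyFinitelyGenerated E.geom ∧ E.CoinvariantRankConstant) :
    IsTopCharacteristic X.PiTemp X.DeltaTemp := by
  obtain ⟨E, B, ι, g, hι, hg, hc, hΔE, hcr⟩ := h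
  exact X.isTopCharacteristic_deltaTemp_of_completion_coinvariantRankConstant E B hΔE hcr ι hι g hg hc

end TemperedCurve

end Literature.AnabelianGeometry.SemiGraphs

end
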